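import Summits.CriticalPhenomena.PercolationContinuityZ3.Theorems.PercNearOneGluingNoHeavyLowerTailSahiCombSubcube

/-!
# Comb certificates DESCEND to sub-cubes: (M⁺-k) on a cube implies (M⁺-k) on every smaller ground set

Support file (cell `prim-sahi`, seat `prim-sahi-typer` gen 33; `--supports stmt-CriticalPhenomena-4575`).  Pure proofs, no definitions, no
`sorry`, standard axioms.  Companion of P3's `…SahiCombSubcube` (`SahiCombJunta.CombPos.comp_restr`: certificates on the sub-cube `↥W` pull BACK
to `ι`; `sahiE_comp_restr`: `E_k` of pulled-back events under `μ_p` is `E_k` on `↥W` under `μ_{p|W}`).  Here the converse transport: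

* `SahiCombJunta.CombPos.of_comp_restr` — if `p ↦ G(p|_W)` is comb-positive of constant multidegree `c` on `[0,1]^ι` then `G` is comb-positive of
  multidegree `c` on `[0,1]^W` (evaluate the certificate at the points vanishing off `W`: the basis functions of profiles supported off `W` die,
  the others restrict);
* `SahiCombJunta.combPos_sahiE_of_equiv_subtype`, **`combPos_sahiE_of_injective`** — (M⁺-k) for the families of increasing events of `2^κ`
  follows from (M⁺-k) on `2^ι` whenever `κ` embeds in `ι` (pull the family back along the restriction to the image, descend, relabel); in
  particular `combPos_sahiE_of_card_le` — (M⁺-k) on `Fin m` gives (M⁺-k) on every ground set with `≤ m` elements.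
Consumer: …`SahiCombCubeFiveAllOrders` (every order on every ground set of size `≤ 5` from the five-cube). [this work]
-/

noncomputable section

open scoped Classical

namespace Summit.CriticalPhenomena.PercolationContinuityZ3.Theorems

namespace SahiCombJunta

open Finset Function
open Literature.Combinatorics.Sahi2008
open Literature.Probability.Percolation.DecisionTree (ind ind_of_mem ind_of_not_mem)
open SahiComb

variable {ι : Type} [Fintype ι]

/-- **Comb certificates descend to a sub-cube.**  If `p ↦ G (p|_W)` is comb-positive of constant multidegree `c` on `[0,1]^ι`, then `G` is
comb-positive of multidegree `c` on `[0,1]^W`. [this work] -/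
theorem CombPos.of_comp_restr (W : Set ι) {c : ℕ} {G : (↥W → unitInterval) → ℝ}
    (h : CombPos (fun _ : ι => c) (fun p : ι → unitInterval => G (p ∘ Subtype.val))) :
    CombPos (fun _ : ↥W => c) G := by
  obtain ⟨N, hN, hF⟩ := h
  -- extension of a `W`-profile / `W`-point by zero
  let ext : (↥W → ℕ) → ι → ℕ := fun j' e => if he : e ∈ W then j' ⟨e, he⟩ else 0
  refine ⟨fun j' => N (ext j'), fun j' => hN _, fun q => ?_⟩
  let P : ι → unitInterval := fun e => if he : e ∈ W then q ⟨e, he⟩ else 0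
  have hPq : (P ∘ Subtype.val) = q := by
    funext x; simp only [Function.comp, P, x.2, dif_pos]
  have h1 : G q = ∑ j ∈ box (fun _ : ι => c), N j * bern (fun _ : ι => c) j P := by
    have h0 := hF P
    beta_reduce at h0
    rw [hPq] at h0
    exact h0
  rw [h1]
  have hext_inj : Set.InjOn ext (box (fun _ : ↥W => c) : Set (↥W → ℕ)) := by
    intro j₁ _ j₂ _ h12
    funext x
    have := congrFun h12 x.1
    simp only [ext, x.2, dif_pos] at this
    exact this
  have himg : (box (fun _ : ↥W => c)).image ext ⊆ box (fun _ : ι => c) := by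
    intro j hj
    obtain ⟨j', hj', rfl⟩ := mem_image.1 hj
    rw [mem_box] at hj' ⊢
    intro e
    by_cases he : e ∈ W
    · simp only [ext, he, dif_pos]; exact hj' ⟨e, he⟩
    · simp only [ext, he, dif_neg, not_false_eq_true, zero_le]
  -- profiles outside the image are nonzero somewhere off `W`, where `P` vanishes
  have hvan : ∀ j ∈ box (fun _ : ι => c), j ∉ (box (fun _ : ↥W => c)).image ext → N j * bern (fun _ : ι => c) j P = 0 := by
    intro j hj hjn
    have hne : ∃ e, e ∉ W ∧ j e ≠ 0 := by
      by_contra hall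
      push Not at hall
      refine hjn (mem_image.2 ⟨fun x => j x.1, ?_, ?_⟩)
      · rw [mem_box] at hj ⊢; exact fun x => hj x.1
      · funext e
        by_cases he : e ∈ W
        · simp only [ext, he, dif_pos]
        · simp only [ext, he, dif_neg, not_false_eq_true]; exact (hall e he).symm
    obtain ⟨e, heW, hje⟩ := hne
    have hb : bern (fun _ : ι => c) j P = 0 := by
      unfold bern
      refine prod_eq_zero (mem_univ e) ?_
      have hPe : ((P e : unitInterval) : ℝ) = 0 := by simp only [P, heW, dif_neg, not_false_eq_true]; rfl
      rw [hPe, zero_pow hje, zero_mul]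
    rw [hb, mul_zero]
  rw [← sum_subset himg (fun j hj hjn => hvan j hj hjn), sum_image hext_inj]
  refine sum_congr rfl fun j' _ => ?_
  congr 1
  -- the basis functions agree: off `W` the factor is `0^0 · 1^c = 1`
  unfold bern
  rw [← Fintype.prod_subtype_mul_prod_subtype (fun e => e ∈ W)]
  have h2 : (∏ x : {e // ¬ e ∈ W}, (((P x.1 : unitInterval) : ℝ) ^ (ext j' x.1) * (1 - ((P x.1 : unitInterval) : ℝ)) ^ (c - ext j' x.1))) = 1 :=
    Finset.prod_eq_one fun x _ => by
      have hPx : ((P x.1 : unitInterval) : ℝ) = 0 := by simp only [P, x.2, dif_neg, not_false_eq_true]; rfl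
      simp only [ext, x.2, dif_neg, not_false_eq_true, pow_zero, Nat.sub_zero, hPx, sub_zero, one_pow, mul_one]
  rw [h2, mul_one]
  refine Fintype.prod_congr _ _ fun x => ?_
  have hPx : P x.1 = q x := by simp only [P, x.2, dif_pos]
  simp only [ext, x.2, dif_pos, hPx]

/-- **(M⁺-k) descends to a sub-cube up to relabelling**: for `W ⊆ ι` and `e : κ ≃ ↥W`, (M⁺-k) for the `k`-families of increasing events of
`2^ι` gives (M⁺-k) for those of `2^κ` (pull back along the restriction to `W`, descend, relabel). [this work] -/
theorem combPos_sahiE_of_equiv_subtype {κ : Type} [Fintype κ] {k : ℕ} (W : Set ι) (e : κ ≃ ↥W)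
    (h : ∀ U : Fin k → Set (Set ι), (∀ j, IsUpperSet (U j)) →
      CombPos (fun _ : ι => k) (fun p => sahiE (bernoulliWeight p) k (fun j => ind (U j))))
    (V : Fin k → Set (Set κ)) (hV : ∀ j, IsUpperSet (V j)) :
    CombPos (fun _ : κ => k) (fun p => sahiE (bernoulliWeight p) k (fun j => ind (V j))) := by
  -- the family transported to the sub-cube `↥W`, then pulled back to `ι`
  have hV' : ∀ j, IsUpperSet (ThreePartition.comapFam e.symm (V j)) := fun j => SahiC4CombBridge.isUpperSet_comapFam e (hV j)
  have hU : ∀ j, IsUpperSet {ω : Set ι | restr W ω ∈ ThreePartition.comapFam e.symm (V j)} := by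
    intro j ω ω' hle hω
    have hle' : restr W ω ≤ restr W ω' := fun x hx => hle hx
    exact hV' j hle' hω
  have hind : ∀ j, ind {ω : Set ι | restr W ω ∈ ThreePartition.comapFam e.symm (V j)} =
      ind (ThreePartition.comapFam e.symm (V j)) ∘ restr W := by
    intro j; funext ω
    by_cases hω : restr W ω ∈ ThreePartition.comapFam e.symm (V j)
    · rw [Function.comp_apply, ind_of_mem hω, ind_of_mem]
      exact hω
    · rw [Function.comp_apply, ind_of_not_mem hω, ind_of_not_mem]
      exact hω
  -- (M⁺-k) on `ι` for the pulled-back family, rewritten through the sub-cube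
  have hcube : CombPos (fun _ : ι => k) (fun p : ι → unitInterval =>
      sahiE (bernoulliWeight (p ∘ Subtype.val)) k (fun j => ind (ThreePartition.comapFam e.symm (V j)))) := by
    refine (h _ hU).congr fun p => ?_
    rw [← sahiE_comp_restr W p k (fun j => ind (ThreePartition.comapFam e.symm (V j)))]
    exact congrArg _ (funext fun j => (hind j).symm)
  have hW : CombPos (fun _ : ↥W => k)
      (fun q => sahiE (bernoulliWeight q) k (fun j => ind (ThreePartition.comapFam e.symm (V j)))) :=
    CombPos.of_comp_restr W hcube
  -- relabel `↥W ≃ κ`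
  have ht := SahiC4CombBridge.CombPos.comp_equiv e hW
  refine ht.congr fun p => ?_
  exact (SahiC4CombBridge.sahiE_bernoulliWeight_comap_equiv e p k V).symm

/-- **(M⁺-k) descends along an injection of ground sets** `f : κ ↪ ι`. [this work] -/
theorem combPos_sahiE_of_injective {κ : Type} [Fintype κ] {k : ℕ} (f : κ → ι) (hf : Function.Injective f)
    (h : ∀ U : Fin k → Set (Set ι), (∀ j, IsUpperSet (U j)) →
      CombPos (fun _ : ι => k) (fun p => sahiE (bernoulliWeight p) k (fun j => ind (U j))))
    (V : Fin k → Set (Set κ)) (hV : ∀ j, IsUpperSet (V j)) :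
    CombPos (fun _ : κ => k) (fun p => sahiE (bernoulliWeight p) k (fun j => ind (V j))) :=
  combPos_sahiE_of_equiv_subtype (Set.range f) (Equiv.ofInjective f hf) h V hV

/-- **(M⁺-k) on `Fin m` gives (M⁺-k) on every ground set with at most `m` elements.** [this work] -/
theorem combPos_sahiE_of_card_le {κ : Type} [Fintype κ] {m k : ℕ} (hκ : Fintype.card κ ≤ m)
    (h : ∀ U : Fin k → Set (Set (Fin m)), (∀ j, IsUpperSet (U j)) →
      CombPos (fun _ : Fin m => k) (fun p => sahiE (bernoulliWeight p) k (fun j => ind (U j))))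
    (V : Fin k → Set (Set κ)) (hV : ∀ j, IsUpperSet (V j)) :
    CombPos (fun _ : κ => k) (fun p => sahiE (bernoulliWeight p) k (fun j => ind (V j))) := by
  let f : κ → Fin m := fun x => Fin.castLE hκ (Fintype.equivFin κ x)
  have hf : Function.Injective f := fun x y hxy =>
    (Fintype.equivFin κ).injective (Fin.castLE_injective hκ hxy)
  exact combPos_sahiE_of_injective f hf h V hV

end SahiCombJunta

end Summit.CriticalPhenomena.PercolationContinuityZ3.Theorems
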